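import Summits.Langlands.Langlands.Theorems.SqrtFiveQuarticCoversCertS3H12WeakNF
import Summits.Langlands.Langlands.Theorems.SqrtFiveQuarticCoversCertS3H12Y2LiftRealA
import Summits.Langlands.Langlands.Theorems.SqrtFiveQuarticCoversCertS3H12Y2LiftRealB
import HarnessLib

/-!
# Route `Langlands/SqrtFiveQuarticCovers`, certificate `CertS3H12` (sheet 4.7): the certified datum
# «CASE 2 EMPTY» re-typed UPSTREAM as a point-class census of the ℚ-curve `Y₂ = X(s3,ns⁺5)`

Cell `pub/lg-quartmod` (F-L1), engine seat eng-4 g4 (item S3H12-Y2CENSUS).  LABEL OF RECORD (cell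
STATUS 2026-08-28T23:29Z): «`RefinedLocusModular` CLOSED-IN-TREE modulo 13 named inputs»; one of them,
`hDat′` (stub `CaseTwoEmptyS3H12`, smooth form; Record v4 p677950), is the cell's THEOREM (E8, CASE 2)
typed on the four-coordinate model `(t, n, ṽ, w)` of the genus-`7` carrier `X = X(s3,H12)` over
`k = ℚ(√5)` — a model that involves the CELL-DERIVED `H12`-conic `(5 + 2√5)·w² = 8t² − 12t + 7`.

THIS file offers the same datum one level UPSTREAM, in the shape of Record rows 1 / 6 (a POINT LIST on
a curve given by PRINT, plus kernel algebra):

* `hY2` — **Y₂-CENSUS (certified finite datum, NAMED).**  «For `K` a quartic number field and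
  `r ∈ K`, `r² = 5`: every `K`-point `(t, n, ṽ)` of the model `{n³ = t³ + 2t² − 1,
  ṽ² = M² + 12MD + 144D²}` (`M = 5(2t+1)(2t²−3t+3)n`, `D = (t²+t−1)²`) of the genus-`3` curve
  `Y₂ = X(s3,ns⁺5)` — built from Zywina's hauptmoduln `J₂` (`N_s(3)`) and `J₇` (`N_ns⁺(5)`)
  [Zywina2015 §1.2–1.3] over `E = X(ns3,ns⁺5) = 225a1`, a curve over `ℚ`; NO conic, NO `w` — with
  `ṽ ≠ 0` has `(t, n) ∈ (ℚ + ℚr)²`, or `t` satisfies one of ELEVEN explicit quadratic equations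
  `t² + P_i(r′)t + C_i(r′) = 0` over `ℚ + ℚr′` for some `r′ ∈ K` with `r′² = 5` (`r′ = ±r`).»
  This is the cell's **Y₂-form census**: the quadratic points of `X(s3,ns⁺5)` over `ℚ(√5)` off the
  pull-backs of `E(k)` form exactly eleven `(S, λ)`-classes — eng-5 R5-E8-Y2FORM-6F.md §1 (E)
  (β = 1 − ν₃ Prym sieve on its own model `X3`, 39/39 classes closed, kit j317355 et al.; the one
  exact COMPLETENESS lineage), eng-4 E8-POINTS.md (S-search kit j315247: ten classes found with
  fields, `A ∈ K²`, `B ∉ K²`), eng-5 R5-6E / eng-1 g2 (the eleventh, `S = −4G+T`), ref-1 liftchk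
  10/10.  The eleven `t`-minimal polynomials below were recomputed exactly by eng-4 g4 (pure python,
  `code/y2census_classes.py`, `evidence/e8y2/y2census_classes.json`) from eng-4's `(S, λ)` list and
  AGREE AS A SET (up to `r ↦ −r`) with those read off eng-5's `exceptional11-j317331.json` — two
  seats, two models, one list.  The named input is the COMPLETENESS of that list (N2: a Prym sieve,
  rank `0` of `J(X(b3,ns⁺5))/k` by exact `L`-values + Kolyvagin–Logachev/Kato, torsion injectivity,
  the étale-lift lemma) — not kernel-replayable; certnum certified the X-form of the sieve
  (RQ-028), not this Y₂-form.
* KERNEL (files `…CertS3H12Y2Lift.lean`, `…Y2LiftRealA.lean`, `…Y2LiftRealB.lean`): classes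
  1, 3, 7, 11 cannot occur over a totally real `K` (their `Δ_i` has a negative conjugate), and for
  classes 2, 4, 5, 6, 8, 9, 10 the conic `(5 ± 2r)·w² = 8t² − 12t + 7` has no solution `w ∈ K`
  (the cell's «`B ∉ K²`» lift test, now a theorem of explicit algebra in `ℚ(r, s)`).

## What is PROVED here (kernel-checked)

* `caseTwoEmptyS3H12_smooth_of_y2Census` — **`hY2 ⟹ hDat′`** with `hDat′` CHARACTER-IDENTICAL to
  the binder of `certS3H12_of_modelIdentificationWeak_of_caseTwoEmpty_smooth` (p673359) /
  `certS3H12_of_modelIdentification_of_caseTwoEmpty_smooth` (p668984), i.e. to the registered stub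
  `CaseTwoEmptyS3H12` (smooth form): given a point `(t, n, ṽ, w)` with `ṽ·w ≠ 0` over a totally real
  quartic `K ∋ r`, apply `hY2` to `(t, n, ṽ)`; an exceptional class is impossible (`r′ = ±r`, and
  `(5 + 2r) = (5 − 2r′)` when `r′ = −r`), so `(t, n) ∈ (ℚ + ℚr)²`.
* `certS3H12_of_modelIdentificationWeak_of_y2Census` — **`hNFw ⟹ hY2 ⟹ CertS3H12`** BY NAME
  (route item stmt-Langlands-23417), via p673359; and `certS3H12_of_modelIdentification_of_y2Census`,
  the same over typ-3's original `hNF` (p668984).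

NET (the planner's / lead's call, not this file's): the `H12`-conic — a cell model identification —
no longer enters any certified-finite-datum binder of sheet 4.7; it survives only inside the MODEL
binder `hNFw`, and `IsTotallyReal` now does kernel work.  HONEST STATUS: CONDITIONAL bookkeeping
(two hypotheses, written out, provenance above) + kernel algebra; closes nothing on the ledger by
itself; the Y₂-census completeness (N2) and the model identification (N1) stay NAMED; «a certified
finite datum is not a modularity statement»; nothing here proves modularity of any elliptic curve.
References: [Zywina2015] arXiv:1508.07660 §1.2–1.3, Lemma 3.4; [Box2022] §1.1, §7.1; Chen 1999
Thm. 3.2; cell files E8-POINTS.md / E8-PRYMSIEVE.md (eng-4), R5-E8-CASE2-6D.md / R5-E8-Y2FORM-6F.md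
(eng-5), CENSUS.md §15 row 4.7.
-/

noncomputable section

set_option linter.dupNamespace false -- project-wide option; `Summit.Langlands.Langlands` is the mandated namespace

open scoped Matrix NumberField Polynomial IntermediateField
open NumberField Polynomial
open Literature.NumberTheory.Automorphic Summit.Langlands.Langlands.Theses.SqrtFiveQuarticCovers

namespace Summit.Langlands.Langlands.Theorems.SqrtFiveQuarticCovers

/-- **`hY2 ⟹ hDat′`: the Y₂-census of `X(s3,ns⁺5)` over `ℚ(√5)` implies CASE 2 EMPTY for
`X(s3,H12)` over totally real quartic fields.**  Hypothesis `hY2` = the cell's Y₂-form census (eleven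
exceptional `(S, λ)`-classes; eng-5 R5-6F §1 (E) for completeness, eng-4 E8-POINTS + eng-5 R5-6E for
the classes; the eleven `t`-minimal polynomials agree between the two seats' data) — NAMED, not
proved.  Conclusion = the binder `hDat′` of p673359 / p668984 verbatim (registered stub
`CaseTwoEmptyS3H12`, smooth form).  Proof: the eleven classes are excluded by
`y2classNN_not_totallyReal` (1, 3, 7, 11) and `y2classNN_no_lift` (2, 4, 5, 6, 8, 9, 10).
CONDITIONAL bookkeeping; a certified finite datum is not a modularity statement.
[cite: Zywina2015, §1.2–1.3] -/
theorem caseTwoEmptyS3H12_smooth_of_y2Census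
    (hY2 : ∀ (K : Type) [Field K] [NumberField K], Module.finrank ℚ K = 4 →
        ∀ r : K, r ^ 2 = 5 →
          ∀ t n v : K,
            n ^ 3 = t ^ 3 + 2 * t ^ 2 - 1 →
            v ^ 2 = (5 * (2 * t + 1) * (2 * t ^ 2 - 3 * t + 3) * n) ^ 2
                + 12 * (5 * (2 * t + 1) * (2 * t ^ 2 - 3 * t + 3) * n) * (t ^ 2 + t - 1) ^ 2
                + 144 * (t ^ 2 + t - 1) ^ 4 →
            v ≠ 0 →
            ((∃ a b : ℚ, t = (a : K) + (b : K) * r) ∧ (∃ a b : ℚ, n = (a : K) + (b : K) * r)) ∨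
            ∃ r' : K, r' ^ 2 = 5 ∧
              (t ^ 2 + ((7/2 : ℚ) : K) * t + ((13/2 : ℚ) : K) = 0 ∨
               t ^ 2 + ((4/19 : ℚ) : K) * t + ((-14/19 : ℚ) : K) = 0 ∨
               t ^ 2 + (((-1/14 : ℚ) : K) + ((3/7 : ℚ) : K) * r') * t + (((1/14 : ℚ) : K) + ((-1/7 : ℚ) : K) * r') = 0 ∨
               t ^ 2 + (((-7/11 : ℚ) : K) + ((13/22 : ℚ) : K) * r') * t + (((45/484 : ℚ) : K) + ((-173/484 : ℚ) : K) * r') = 0 ∨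
               t ^ 2 + (((4723/3076 : ℚ) : K) + ((-929/3076 : ℚ) : K) * r') * t + (((-135/3076 : ℚ) : K) + ((-1361/3076 : ℚ) : K) * r') = 0 ∨
               t ^ 2 + ((11/19 : ℚ) : K) * t + ((-35/19 : ℚ) : K) = 0 ∨
               t ^ 2 + ((-1/2 : ℚ) : K) * t + (((-1/2 : ℚ) : K) + ((1/2 : ℚ) : K) * r') = 0 ∨
               t ^ 2 + (((13/14 : ℚ) : K) + ((-17/14 : ℚ) : K) * r') * t + (((23/14 : ℚ) : K) + ((-9/14 : ℚ) : K) * r') = 0 ∨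
               t ^ 2 + ((-1/2 : ℚ) : K) = 0 ∨
               t ^ 2 + (((101/76 : ℚ) : K) + ((-31/76 : ℚ) : K) * r') * t + (((-13/8 : ℚ) : K) + ((1/8 : ℚ) : K) * r') = 0 ∨
               t ^ 2 + (((-983/662 : ℚ) : K) + ((527/662 : ℚ) : K) * r') * t + (((379/331 : ℚ) : K) + ((-317/331 : ℚ) : K) * r') = 0)) :
    ∀ (K : Type) [Field K] [NumberField K], NumberField.IsTotallyReal K → Module.finrank ℚ K = 4 →
      ∀ r : K, r ^ 2 = 5 →
        ∀ t n v w : K,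
          n ^ 3 = t ^ 3 + 2 * t ^ 2 - 1 →
          v ^ 2 = (5 * (2 * t + 1) * (2 * t ^ 2 - 3 * t + 3) * n) ^ 2
              + 12 * (5 * (2 * t + 1) * (2 * t ^ 2 - 3 * t + 3) * n) * (t ^ 2 + t - 1) ^ 2
              + 144 * (t ^ 2 + t - 1) ^ 4 →
          (5 + 2 * r) * w ^ 2 = 8 * t ^ 2 - 12 * t + 7 →
          v ≠ 0 → w ≠ 0 →
          (∃ a b : ℚ, t = (a : K) + (b : K) * r) ∧ (∃ a b : ℚ, n = (a : K) + (b : K) * r) := by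
  intro K _ _ hK hd r hr t n v w hn hv hW hv0 _hw0
  haveI : IsTotallyReal K := hK
  rcases hY2 K hd r hr t n v hn hv hv0 with h0 | ⟨r', hr', hcl⟩
  · exact h0
  · exfalso
    have hrr : r' = r ∨ r' = -r := by
      have hp : (r' - r) * (r' + r) = 0 := by linear_combination hr' - hr
      rcases mul_eq_zero.mp hp with h | h
      · left; linear_combination h
      · right; linear_combination h
    have hW' : (5 + 2 * r') * w ^ 2 = 8 * t ^ 2 - 12 * t + 7 ∨
        (5 - 2 * r') * w ^ 2 = 8 * t ^ 2 - 12 * t + 7 := by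
      rcases hrr with rfl | rfl
      · exact Or.inl hW
      · exact Or.inr (by linear_combination hW)
    rcases hcl with h1 | h2 | h3 | h4 | h5 | h6 | h7 | h8 | h9 | h10 | h11
    · exact y2class01_not_totallyReal hr' h1
    · rcases hW' with h | h
      · exact (y2class02_no_lift hd hr' h2 w).1 h
      · exact (y2class02_no_lift hd hr' h2 w).2 h
    · exact y2class03_not_totallyReal hr' h3
    · rcases hW' with h | h
      · exact (y2class04_no_lift hd hr' h4 w).1 h
      · exact (y2class04_no_lift hd hr' h4 w).2 h
    · rcases hW' with h | h
      · exact (y2class05_no_lift hd hr' h5 w).1 h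
      · exact (y2class05_no_lift hd hr' h5 w).2 h
    · rcases hW' with h | h
      · exact (y2class06_no_lift hd hr' h6 w).1 h
      · exact (y2class06_no_lift hd hr' h6 w).2 h
    · exact y2class07_not_totallyReal hr' h7
    · rcases hW' with h | h
      · exact (y2class08_no_lift hd hr' h8 w).1 h
      · exact (y2class08_no_lift hd hr' h8 w).2 h
    · rcases hW' with h | h
      · exact (y2class09_no_lift hd hr' h9 w).1 h
      · exact (y2class09_no_lift hd hr' h9 w).2 h
    · rcases hW' with h | h
      · exact (y2class10_no_lift hd hr' h10 w).1 h
      · exact (y2class10_no_lift hd hr' h10 w).2 h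
    · exact y2class11_not_totallyReal hr' h11

/-- **`CertS3H12` from the WEAK model identification `hNFw` and the Y₂-census `hY2`** (route item
stmt-Langlands-23417 BY NAME), via `certS3H12_of_modelIdentificationWeak_of_caseTwoEmpty_smooth`
(eng-4 g3, p673359) and `caseTwoEmptyS3H12_smooth_of_y2Census`.  Hypotheses: `hNFw` = NF-K1 for
`X(s3,H12)` in its weak form (moduli interpretation [Chen 1999 Thm 3.2 / Deligne–Rapoport IV-3] +
Zywina's `J₂`, `J₇` + the cell's `H12`-conic; MODEL, named); `hY2` = Y₂-census (CFC point-class list,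
named; provenance in the module docstring).  CONDITIONAL bookkeeping; a certified finite datum is not
a modularity statement; nothing here proves modularity of a new class.
[cite: Zywina2015, §1.2–1.3, Lemma 3.4] [cite: Box2022, §1.1, §7.1] -/
theorem certS3H12_of_modelIdentificationWeak_of_y2Census
    (hNFw : ∀ (K : Type) [Field K] [NumberField K], NumberField.IsTotallyReal K → Module.finrank ℚ K = 4 → (∃ r : K, r ^ 2 = 5) →
        ∀ E : WeierstrassCurve (NumberField.RingOfIntegers K), E.Δ ≠ 0 →
          (∃ ρ : Literature.NumberTheory.GaloisRepresentations.FramedGaloisRep K (ZMod 3) 2, (∃ e : (E.baseChange K).geomTorsion ((3 : ℕ) : ℤ) ≃+ (Fin 2 → ZMod 3), ∀ (σ : Field.absoluteGaloisGroup K) (P : (E.baseChange K).geomTorsion ((3 : ℕ) : ℤ)), e (σ • P) = ((ρ σ : GL (Fin 2) (ZMod 3)) : Matrix (Fin 2) (Fin 2) (ZMod 3)) *ᵥ (e P)) ∧ ((∀ σ : Field.absoluteGaloisGroup K, (ρ σ : GL (Fin 2) (ZMod 3)) ∈ Subgroup.closure ({(⟨!![1, 0; 0, 2], !![1, 0; 0,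 2], by decide, by decide⟩ : GL (Fin 2) (ZMod 3)), (⟨!![0, 1; 1, 0], !![0, 1; 1, 0], by decide, by decide⟩ : GL (Fin 2) (ZMod 3))} : Set (GL (Fin 2) (ZMod 3)))))) →
          (∃ ρ : Literature.NumberTheory.GaloisRepresentations.FramedGaloisRep K (ZMod 5) 2, (∃ e : (E.baseChange K).geomTorsion ((5 : ℕ) : ℤ) ≃+ (Fin 2 → ZMod 5), ∀ (σ : Field.absoluteGaloisGroup K) (P : (E.baseChange K).geomTorsion ((5 : ℕ) : ℤ)), e (σ • P) = ((ρ σ : GL (Fin 2) (ZMod 5)) : Matrix (Fin 2) (Fin 2) (ZMod 5)) *ᵥ (e P)) ∧ ((∀ σ : Field.absoluteGaloisGroup K, (ρ σ : GL (Fin 2) (ZMod 5)) ∈ Subgroup.closure ({(⟨!![3, 1; 3, 3], !![3, 4; 2, 3], by decide, by decide⟩ : GL (Fin 2) (ZMod 5)), (⟨!![1, 0; 0, 4], !![1, 0; 0, 4], by decide, by decide⟩ : GL (Fin 2) (ZMod 5))} : Set (GL (Fin 2) (ZMod 5)))))) →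
          ∀ r : K, r ^ 2 = 5 →
            (E.baseChange K).c₄ = 0 ∨
            (E.baseChange K).c₄ ^ 3 = 8000 * (E.baseChange K).Δ ∨
            ∃ u t w : K,
              (E.baseChange K).c₄ ^ 3 * u ^ 3 = 27 * (u + 1) ^ 3 * (u - 3) ^ 3 * (E.baseChange K).Δ ∧
              (E.baseChange K).c₄ ^ 3 * (t ^ 2 + t - 1) ^ 5 =
                125 * (t + 1) * (2 * t + 1) ^ 3 * (2 * t ^ 2 - 3 * t + 3) ^ 3 * (E.baseChange K).Δ ∧
              (5 + 2 * r) * w ^ 2 = 8 * t ^ 2 - 12 * t + 7)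
    (hY2 : ∀ (K : Type) [Field K] [NumberField K], Module.finrank ℚ K = 4 →
        ∀ r : K, r ^ 2 = 5 →
          ∀ t n v : K,
            n ^ 3 = t ^ 3 + 2 * t ^ 2 - 1 →
            v ^ 2 = (5 * (2 * t + 1) * (2 * t ^ 2 - 3 * t + 3) * n) ^ 2
                + 12 * (5 * (2 * t + 1) * (2 * t ^ 2 - 3 * t + 3) * n) * (t ^ 2 + t - 1) ^ 2
                + 144 * (t ^ 2 + t - 1) ^ 4 →
            v ≠ 0 →
            ((∃ a b : ℚ, t = (a : K) + (b : K) * r) ∧ (∃ a b : ℚ, n = (a : K) + (b : K) * r)) ∨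
            ∃ r' : K, r' ^ 2 = 5 ∧
              (t ^ 2 + ((7/2 : ℚ) : K) * t + ((13/2 : ℚ) : K) = 0 ∨
               t ^ 2 + ((4/19 : ℚ) : K) * t + ((-14/19 : ℚ) : K) = 0 ∨
               t ^ 2 + (((-1/14 : ℚ) : K) + ((3/7 : ℚ) : K) * r') * t + (((1/14 : ℚ) : K) + ((-1/7 : ℚ) : K) * r') = 0 ∨
               t ^ 2 + (((-7/11 : ℚ) : K) + ((13/22 : ℚ) : K) * r') * t + (((45/484 : ℚ) : K) + ((-173/484 : ℚ) : K) * r') = 0 ∨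
               t ^ 2 + (((4723/3076 : ℚ) : K) + ((-929/3076 : ℚ) : K) * r') * t + (((-135/3076 : ℚ) : K) + ((-1361/3076 : ℚ) : K) * r') = 0 ∨
               t ^ 2 + ((11/19 : ℚ) : K) * t + ((-35/19 : ℚ) : K) = 0 ∨
               t ^ 2 + ((-1/2 : ℚ) : K) * t + (((-1/2 : ℚ) : K) + ((1/2 : ℚ) : K) * r') = 0 ∨
               t ^ 2 + (((13/14 : ℚ) : K) + ((-17/14 : ℚ) : K) * r') * t + (((23/14 : ℚ) : K) + ((-9/14 : ℚ) : K) * r') = 0 ∨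
               t ^ 2 + ((-1/2 : ℚ) : K) = 0 ∨
               t ^ 2 + (((101/76 : ℚ) : K) + ((-31/76 : ℚ) : K) * r') * t + (((-13/8 : ℚ) : K) + ((1/8 : ℚ) : K) * r') = 0 ∨
               t ^ 2 + (((-983/662 : ℚ) : K) + ((527/662 : ℚ) : K) * r') * t + (((379/331 : ℚ) : K) + ((-317/331 : ℚ) : K) * r') = 0)) :
    CertS3H12 :=
  certS3H12_of_modelIdentificationWeak_of_caseTwoEmpty_smooth hNFw
    (caseTwoEmptyS3H12_smooth_of_y2Census hY2)

/-- **`CertS3H12` from typ-3's model identification `hNF` (with side conditions) and the Y₂-census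
`hY2`**, via `certS3H12_of_modelIdentification_of_caseTwoEmpty_smooth` (typ-3, p668984).
CONDITIONAL bookkeeping; a certified finite datum is not a modularity statement.
[cite: Zywina2015, §1.2–1.3, Lemma 3.4] [cite: Box2022, §1.1, §7.1] -/
theorem certS3H12_of_modelIdentification_of_y2Census
    (hNF : ∀ (K : Type) [Field K] [NumberField K], NumberField.IsTotallyReal K → Module.finrank ℚ K = 4 → (∃ r : K, r ^ 2 = 5) →
        ∀ E : WeierstrassCurve (NumberField.RingOfIntegers K), E.Δ ≠ 0 →
          (∃ ρ : Literature.NumberTheory.GaloisRepresentations.FramedGaloisRep K (ZMod 3) 2, (∃ e : (E.baseChange K).geomTorsion ((3 : ℕ) : ℤ) ≃+ (Fin 2 → ZMod 3), ∀ (σ : Field.absoluteGaloisGroup K) (P : (E.baseChange K).geomTorsion ((3 : ℕ) : ℤ)), e (σ • P) = ((ρ σ : GL (Fin 2) (ZMod 3)) : Matrix (Fin 2) (Fin 2) (ZMod 3)) *ᵥ (e P)) ∧ ((∀ σ : Field.absoluteGaloisGroup K, (ρ σ : GL (Fin 2) (ZMod 3)) ∈ Subgroup.closure ({(⟨!![1,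 0; 0, 2], !![1, 0; 0, 2], by decide, by decide⟩ : GL (Fin 2) (ZMod 3)), (⟨!![0, 1; 1, 0], !![0, 1; 1, 0], by decide, by decide⟩ : GL (Fin 2) (ZMod 3))} : Set (GL (Fin 2) (ZMod 3)))))) →
          (∃ ρ : Literature.NumberTheory.GaloisRepresentations.FramedGaloisRep K (ZMod 5) 2, (∃ e : (E.baseChange K).geomTorsion ((5 : ℕ) : ℤ) ≃+ (Fin 2 → ZMod 5), ∀ (σ : Field.absoluteGaloisGroup K) (P : (E.baseChange K).geomTorsion ((5 : ℕ) : ℤ)), e (σ • P) = ((ρ σ : GL (Fin 2) (ZMod 5)) : Matrix (Fin 2) (Fin 2) (ZMod 5)) *ᵥ (e P)) ∧ ((∀ σ : Field.absoluteGaloisGroup K, (ρ σ : GL (Fin 2) (ZMod 5)) ∈ Subgroup.closure ({(⟨!![3, 1; 3, 3], !![3, 4; 2, 3], by decide, by decide⟩ : GL (Fin 2) (ZMod 5)), (⟨!![1, 0; 0, 4], !![1, 0; 0, 4], by decide, by decide⟩ : GL (Fin 2) (ZMod 5))} : Set (GL (Fin 2) (ZMod 5)))))) →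
          ∀ r : K, r ^ 2 = 5 →
            (E.baseChange K).c₄ = 0 ∨
            (E.baseChange K).c₄ ^ 3 = 8000 * (E.baseChange K).Δ ∨
            ∃ u t w : K, u ≠ 0 ∧
              (E.baseChange K).c₄ ^ 3 * u ^ 3 = 27 * (u + 1) ^ 3 * (u - 3) ^ 3 * (E.baseChange K).Δ ∧
              t ^ 2 + t - 1 ≠ 0 ∧
              (E.baseChange K).c₄ ^ 3 * (t ^ 2 + t - 1) ^ 5 =
                125 * (t + 1) * (2 * t + 1) ^ 3 * (2 * t ^ 2 - 3 * t + 3) ^ 3 * (E.baseChange K).Δ ∧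
              (5 + 2 * r) * w ^ 2 = 8 * t ^ 2 - 12 * t + 7)
    (hY2 : ∀ (K : Type) [Field K] [NumberField K], Module.finrank ℚ K = 4 →
        ∀ r : K, r ^ 2 = 5 →
          ∀ t n v : K,
            n ^ 3 = t ^ 3 + 2 * t ^ 2 - 1 →
            v ^ 2 = (5 * (2 * t + 1) * (2 * t ^ 2 - 3 * t + 3) * n) ^ 2
                + 12 * (5 * (2 * t + 1) * (2 * t ^ 2 - 3 * t + 3) * n) * (t ^ 2 + t - 1) ^ 2
                + 144 * (t ^ 2 + t - 1) ^ 4 →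
            v ≠ 0 →
            ((∃ a b : ℚ, t = (a : K) + (b : K) * r) ∧ (∃ a b : ℚ, n = (a : K) + (b : K) * r)) ∨
            ∃ r' : K, r' ^ 2 = 5 ∧
              (t ^ 2 + ((7/2 : ℚ) : K) * t + ((13/2 : ℚ) : K) = 0 ∨
               t ^ 2 + ((4/19 : ℚ) : K) * t + ((-14/19 : ℚ) : K) = 0 ∨
               t ^ 2 + (((-1/14 : ℚ) : K) + ((3/7 : ℚ) : K) * r') * t + (((1/14 : ℚ) : K) + ((-1/7 : ℚ) : K) * r') = 0 ∨
               t ^ 2 + (((-7/11 : ℚ) : K) + ((13/22 : ℚ) : K) * r') * t + (((45/484 : ℚ) : K) + ((-173/484 : ℚ) : K) * r') = 0 ∨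
               t ^ 2 + (((4723/3076 : ℚ) : K) + ((-929/3076 : ℚ) : K) * r') * t + (((-135/3076 : ℚ) : K) + ((-1361/3076 : ℚ) : K) * r') = 0 ∨
               t ^ 2 + ((11/19 : ℚ) : K) * t + ((-35/19 : ℚ) : K) = 0 ∨
               t ^ 2 + ((-1/2 : ℚ) : K) * t + (((-1/2 : ℚ) : K) + ((1/2 : ℚ) : K) * r') = 0 ∨
               t ^ 2 + (((13/14 : ℚ) : K) + ((-17/14 : ℚ) : K) * r') * t + (((23/14 : ℚ) : K) + ((-9/14 : ℚ) : K) * r') = 0 ∨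
               t ^ 2 + ((-1/2 : ℚ) : K) = 0 ∨
               t ^ 2 + (((101/76 : ℚ) : K) + ((-31/76 : ℚ) : K) * r') * t + (((-13/8 : ℚ) : K) + ((1/8 : ℚ) : K) * r') = 0 ∨
               t ^ 2 + (((-983/662 : ℚ) : K) + ((527/662 : ℚ) : K) * r') * t + (((379/331 : ℚ) : K) + ((-317/331 : ℚ) : K) * r') = 0)) :
    CertS3H12 :=
  certS3H12_of_modelIdentification_of_caseTwoEmpty_smooth hNF
    (caseTwoEmptyS3H12_smooth_of_y2Census hY2)

end Summit.Langlands.Langlands.Theorems.SqrtFiveQuarticCovers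

end
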